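import Mathlib.RingTheory.Coprime.Lemmas
import Mathlib.RingTheory.Int.Basic
import Mathlib.Algebra.EuclideanDomain.Int
import Mathlib.Data.Nat.Prime.Basic
import Mathlib.RingTheory.PrincipalIdealDomain
import Mathlib.Data.Int.GCD
import Mathlib.Data.Int.ModEq
import Mathlib.Data.Nat.ChineseRemainder
import Mathlib.Algebra.Order.Group.Int
import HarnessLib

/-!
# The ordinary cusps of `X₁(Np^r)`: arithmetic Frobenius at `p` and the Hecke operator `U′_p` are the same permutation — the cusp arithmetic

Elementary number theory, sorry-free, THEOREMS ONLY (no definition, no named fact). This file is the KERNEL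
FORM of the twelve lines of cusp arithmetic of reader 1's **ADDENDUM-7 §2 (T5.2)**
(`pub/bsd-litref/cgs25/sheets/D-AUDIT-cgs25-r1-ADDENDUM-7.md`, sha16 fe75e1e18a060274), which supplies the boundary
identity «arithmetic `Frob_p` = `U′_p` on the cusp quotient of `𝓕⁻H¹_ord(Np^∞)`» of Kings–Loeffler–Zerbes 2017
Thm. 7.2.3(iii) [corpus paper:arxiv-1503.02888 p0031:L66] (= Burungale–Skinner–Tian–Wan Thm. 3.1(ii), second clause)
at EVERY prime `p ∤ N` and every level `r ≥ 1`, on Ohta's basis of the ordinary cusp module — referee C R473 (2)(ii)'s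
condition T5.2 / R484.3(1) O-1 of the `p = 3` audit (cell `bsd-litref`, Ohta-ES@3 node, prong G♭, road (B)).

THE PRINTED FRAME (refereed, `p`-free at the lines used; NOT formalised here — this file checks only the arithmetic):
* cusps of `X₁(M)`, `M = N_r = Np^r`: `Γ₁(M)\P¹(ℚ) ≅ A_M/{±1}`, `g·∞ ↦` the first column `(a;c)` of `g ∈ SL₂(ℤ)`, with
  `(x;y) ~ (x′;y′) iff y = y′ and x ≡ x′ (mod gcd(M, y))` [cite: Ohta1999, (4.3.1)–(4.3.3) (Compositio 115, p. 278–279)]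
  [cite: Lafferty2019, §4.1.1 («A_M := {[x;y] ∈ (ℤ/M)² : gcd(x,y)=1}/~, x ≡ x′ (mod gcd(M,y)), y ≡ y′ (mod M)»)];
  Fukaya–Kato label the same cusp by the bottom row `(c, d)`, `ad − bc = 1`, so `a·d ≡ 1 (mod R)`, `R := gcd(c, M)`
  [cite: FukayaKato2024, §1.3.2];
* the ordinary boundary module `e*ℤ_p[C_r] = ℤ_p[C_r]/D_r`, `D_r = ⟨(a;c) : p ∣ c⟩`, free on Ohta's basis
  `𝔅_r = {[a;c] : p ∤ c}` [cite: Ohta1999, Prop. (4.3.4)] [cite: Lafferty2019, Prop. 4.1];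
* the Hecke operator on the boundary: `U′_p = T*(p)` acts on cusps by the double-coset sum
  `[x] ↦ Σ_{i=0}^{p−1} [(x+i)/p]`, i.e. `[a;c] ↦ Σ_i [the cusp (a+ic)/(pc)]` [cite: Ohta1999, Prop. (3.4.12) and §4.3 (the «natural action of T(p)ⁿ on ℤ_p[C_r]»)] [cite: Lafferty2019, §4.1.2];
* Galois on cusps in the point model: all cusps rational over `ℚ(ζ_M)`, `σ_s : ζ_M ↦ ζ_M^s` acts on the label `(c,d)` by
  `(c, d) ↦ (c, sd)` (conjugating the Tate datum `q^{c/M}ζ_M^d`) [cite: FukayaKato2024, 1.3.3–1.3.4 and Prop. 3.2.4 («the action of Gal(ℚ̄/ℚ(ζ_N)) on (H¹(Y₁(Np^r))^ord/H¹(X₁(Np^r))^ord)(1) is trivial»)];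
  the arithmetic Frobenius `Fr_p ∈ Gal(ℚ(ζ_N)/ℚ)` lifts to `σ_s` with `s ≡ p (mod N)`, `s ≡ 1 (mod p^r)`.

WHAT IS KERNEL-CHECKED (for ALL primes `p`, all `N` with `p ∤ N`, all `r`, all coprime `(a, c)` with `p ∤ c`; `q` an inverse
of `p` modulo `N`, `R` any common divisor of `c` and `N` — in particular `R = gcd(Np^r, c) = gcd(N, c)`, `gcd_mul_pow_eq_gcd`):
* (T5.2-a) HECKE. `dvd_add_mul_iff_modEq`: `p ∣ a + ic` for EXACTLY ONE `i (mod p)`; `isCoprime_add_mul_mul`: for the other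
  `i` the column `(a+ic ; pc)` is primitive — its class lies in `D_r` since `p ∣ pc`; `isCoprime_of_mul_eq_add_mul` +
  `modEq_of_mul_eq_add_mul`: for the surviving `i₀`, writing `a + i₀c = p·b`, the cusp is `b/c` with `gcd(b,c) = 1` and
  `b ≡ q·a (mod R)` — so `U′_p[a;c] ≡ [q a; c] (mod D_r)`.
* (T5.2-b) FROBENIUS. `exists_frobenius_lift`: the lift `s` exists (CRT) and is a unit mod `M`; `dictionary_modEq`: under
  `a·d ≡ 1 (mod R)` the Fukaya–Kato label `(c, s·d)` of `Fr_p·(c,d)` corresponds to Ohta's `(q a ; c)` — so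
  `Fr_p[a;c] = [q a; c]`.
* (T5.2-c) `frobenius_eq_hecke_on_ordinary_cusp_labels`: the two assembled — BOTH operators are the permutation
  `[a;c] ↦ [q a; c]` of `𝔅_r` (equality as operators on `e*ℤ_p[C_r]` then follows on the basis; every Teichmüller component
  at once, `p = 2, 3` included). The exponent check of the sheet's §3(3b) — with `T(p)` in place of `T*(p)` the map would be
  `[a;c] ↦ [p a; c]`, different unless `p² ≡ 1 (mod N)` — is recorded as `modEq_mul_self_iff` (non-vacuity of the check).

LOCATORS. Fukaya–Kato loci verified first-hand by this seat on the author-hosted PDF of the Kyoto J. Math. paper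
[corpus paper:url-03008c92a8a1: 1.2.3 p0009:L18, 1.2.4 p0009:L42, 1.2.5 p0010:L7, 1.3.2 p0011:L6, 1.3.3 p0011:L32, 1.3.4
p0011:L38, 1.3.5 p0011:L48, Prop. 3.2.4 p0048:L17–L20, 3.3.7 p0051:L10–L20]; KLZ17 Thm. 7.2.3 [corpus paper:arxiv-1503.02888
p0031:L50–L68]; Ohta 1999 loci ((3.4.9)–(3.4.12) PDF p. 33 = printed p. 273; (4.3.1)–(4.3.4) PDF pp. 38–40 = printed
pp. 278–280; (4.3.10) p. 41/281; (4.3.11)–(4.3.14) pp. 41–42/281–282) are AS RECORDED in ADD-7 §1 from reader 1's own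
materialisation of `doi:10.1023/A:1000556212097` (this seat's fetch of the Compositio copy timed out; Lafferty 2019 §4.1
restates Ohta's cusp combinatorics verbatim per the same sheet).

HONEST FRAMING: the identification of the cohomological `U′_p` with the double-coset action on cusps, the cusp labelling,
the structure of `e*ℤ_p[C_r]`, and the Galois action on labels are REFEREED PRINT cited above and are NOT formalised; this
file is the arithmetic of ADD-7 §2 for all parameters, nothing more. It bears on no census cell (a reader supplement to
referee C's road-(B) text obligation O-1; the desks' words are the record). Not Ohta's Hodge–Tate construction, not KLZ
7.2.3(iii) for the extension `𝓕⁻𝓗`, not a statement about any elliptic curve; BSD is not proved by any of this.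
References: Ohta, Compositio Math. 115 (1999) §3.4, §4.3; Fukaya–Kato, Kyoto J. Math. 64 (2024) §1.3, Prop. 3.2.4, 3.3.7;
Lafferty, Math. Ann. 375 (2019) §4.1; Kings–Loeffler–Zerbes, Camb. J. Math. 5 (2017) Thm. 7.2.3.
-/

namespace Literature.NumberTheory.ModularForms.OrdinaryCusps

/-! ## §0 Two arithmetic preliminaries -/

/-- A prime not dividing `c` is coprime to `c` (in `ℤ`). [cite: Ohta1999, §4.3 (standing: p ∤ N, cusps (a;c) with p ∤ c)] -/
theorem isCoprime_natCast_of_not_dvd {p : ℕ} (hp : p.Prime) {c : ℤ} (hc : ¬ (p : ℤ) ∣ c) :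
    IsCoprime (p : ℤ) c :=
  (Irreducible.coprime_iff_not_dvd (Nat.prime_iff_prime_int.mp hp).irreducible).mpr hc

/-- `gcd(N·p^r, c) = gcd(N, c)` when `p ∤ c`: for a cusp `[a;c]` of `X₁(Np^r)` in Ohta's ordinary basis (`p ∤ c`) the
modulus `R = gcd(c, Np^r)` governing the first coordinate is `gcd(c, N)`, a divisor of `N`.
[cite: Ohta1999, (4.3.3) and Prop. (4.3.4) (the classes (a;c)_{N_r} with p ∤ c generate ℤ_p[C_r]/D_r)] -/
theorem gcd_mul_pow_eq_gcd {p : ℕ} (hp : p.Prime) {c : ℤ} (hc : ¬ (p : ℤ) ∣ c) (N r : ℕ) :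
    Int.gcd ((N : ℤ) * (p : ℤ) ^ r) c = Int.gcd (N : ℤ) c := by
  have hpc : Nat.Coprime (p ^ r) c.natAbs := by
    refine Nat.Coprime.pow_left r ((Nat.Prime.coprime_iff_not_dvd hp).mpr ?_)
    rwa [← Int.natCast_dvd]
  have h1 : ((N : ℤ) * (p : ℤ) ^ r).natAbs = N * p ^ r := by
    rw [Int.natAbs_mul, Int.natAbs_pow, Int.natAbs_natCast, Int.natAbs_natCast]
  rw [Int.gcd_eq_natAbs, Int.gcd_eq_natAbs, h1, Int.natAbs_natCast]
  exact Nat.Coprime.gcd_mul_right_cancel N hpc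

/-! ## §1 (T5.2-a) The Hecke side: `U′_p [a;c] ≡ [q a; c] (mod D_r)` -/

section Hecke

variable {p : ℕ} (hp : p.Prime) {a c : ℤ}

include hp in
/-- There is an `i₀` with `p ∣ a + i₀ c` (as `c` is a unit mod `p`). [cite: Ohta1999, proof of Prop. (4.3.4) («we may change a and assume that a is divisible by pⁿ»)] -/
theorem exists_dvd_add_mul (hc : ¬ (p : ℤ) ∣ c) (a : ℤ) : ∃ i₀ : ℤ, (p : ℤ) ∣ a + i₀ * c := by
  obtain ⟨u, v, huv⟩ := isCoprime_natCast_of_not_dvd hp hc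
  -- `u p + v c = 1`, so `a = a u p + a v c` and `i₀ := -(a v)` works
  refine ⟨-(a * v), ⟨a * u, ?_⟩⟩
  have : a = a * (u * (p : ℤ) + v * c) := by rw [huv, mul_one]
  nth_rewrite 1 [this]
  ring

include hp in
/-- **Exactly one term survives.** With `p ∣ a + i₀ c` and `p ∤ c`: `p ∣ a + i c ⟺ i ≡ i₀ (mod p)`. So in the Hecke sum
`U′_p[a;c] = Σ_{i mod p} [(a + ic)/(pc)]` precisely one index meets `p ∣ a + ic`.
[cite: Ohta1999, Prop. (3.4.12) and §4.3 (T(p) on ℤ_p[C_r]: x ↦ Σ_{i=0}^{p−1} (x+i)/p); proof of Prop. (4.3.4)] -/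
theorem dvd_add_mul_iff_modEq (hc : ¬ (p : ℤ) ∣ c) {i₀ : ℤ} (h₀ : (p : ℤ) ∣ a + i₀ * c) (i : ℤ) :
    (p : ℤ) ∣ a + i * c ↔ i ≡ i₀ [ZMOD (p : ℤ)] := by
  have hpi : Prime (p : ℤ) := Nat.prime_iff_prime_int.mp hp
  have key : (p : ℤ) ∣ a + i * c ↔ (p : ℤ) ∣ (i - i₀) * c := by
    constructor
    · intro h
      have e : (i - i₀) * c = (a + i * c) - (a + i₀ * c) := by ring
      rw [e]
      exact dvd_sub h h₀
    · intro h
      have e : a + i * c = (i - i₀) * c + (a + i₀ * c) := by ring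
      rw [e]
      exact dvd_add h h₀
  rw [key]
  constructor
  · intro h
    have hd : (p : ℤ) ∣ i - i₀ := (hpi.dvd_or_dvd h).resolve_right hc
    exact (Int.modEq_iff_dvd.mpr hd).symm
  · intro h
    have hd : (p : ℤ) ∣ i - i₀ := Int.modEq_iff_dvd.mp h.symm
    exact Dvd.dvd.mul_right hd c

include hp in
/-- **The non-surviving terms lie in `D_r`.** If `gcd(a, c) = 1` and `p ∤ a + ic`, the column `(a + ic ; pc)` is
primitive, so the cusp `(a+ic)/(pc)` has label `[a + ic ; pc]` with `p ∣ pc`, a generator of `D_r`.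
[cite: Ohta1999, Prop. (4.3.4) (D_r := the span of the (a;c)_{N_r} with p ∣ c is T(p)-stable and e*D_r = 0)] -/
theorem isCoprime_add_mul_mul (hac : IsCoprime a c) {i : ℤ} (hi : ¬ (p : ℤ) ∣ a + i * c) :
    IsCoprime (a + i * c) ((p : ℤ) * c) :=
  IsCoprime.mul_right (isCoprime_natCast_of_not_dvd hp hi).symm (hac.add_mul_right_left i)

/-- **The surviving term, coprimality.** If `gcd(a, c) = 1` and `a + i₀ c = p b`, then `gcd(b, c) = 1`: the cusp
`(a + i₀c)/(pc) = b/c` has Ohta label `[b ; c]` (same second coordinate `c`, `p ∤ c`).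
[cite: Ohta1999, proof of Prop. (4.3.4) («T(p)ⁿ(a;c)_{N_r} ≡ (a/pⁿ; c)_{N_r} mod D_r»)] -/
theorem isCoprime_of_mul_eq_add_mul (hac : IsCoprime a c) {i₀ b : ℤ} (hb : (p : ℤ) * b = a + i₀ * c) :
    IsCoprime b c := by
  have h : IsCoprime ((p : ℤ) * b) c := by rw [hb]; exact hac.add_mul_right_left i₀
  exact h.of_mul_left_right

/-- **The surviving term, first coordinate.** If `a + i₀ c = p b`, `R ∣ c` and `p q ≡ 1 (mod R)`, then
`b ≡ q a (mod R)`: the surviving cusp's label is `[q a ; c]` in `A_M` (first coordinates count modulo `R = gcd(M, c)`).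
This is Ohta's displayed step read at `n = 1` without imposing `pⁿ ≡ 1 (mod N)` (ADD-7 (T5.2-a)).
[cite: Ohta1999, proof of Prop. (4.3.4); (4.3.3) (x ≡ x′ mod y·(ℤ/N_r))] [cite: Lafferty2019, §4.1.1–4.1.2] -/
theorem modEq_of_mul_eq_add_mul {p : ℤ} {i₀ b q R : ℤ} (hRc : R ∣ c) (hq : p * q ≡ 1 [ZMOD R])
    (hb : p * b = a + i₀ * c) : b ≡ q * a [ZMOD R] := by
  obtain ⟨k, hk⟩ := hRc
  -- `p b ≡ a (mod R)`
  have h1 : p * b ≡ a [ZMOD R] :=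
    Int.modEq_iff_dvd.mpr ⟨-(i₀ * k), by rw [hb, hk]; ring⟩
  -- multiply by `q`
  have h2 : q * (p * b) ≡ q * a [ZMOD R] := h1.mul_left q
  have h3 : q * (p * b) ≡ b [ZMOD R] := by
    have e : q * (p * b) = (p * q) * b := by ring
    rw [e]
    simpa using hq.mul_right b
  exact h3.symm.trans h2

end Hecke

/-! ## §2 (T5.2-b) The Galois side: `Fr_p [a;c] = [q a; c]` -/

/-- **A lift of the arithmetic Frobenius.** For `p ∤ N` there is `s` with `s ≡ p (mod N)`, `s ≡ 1 (mod p^r)`, and `s` is a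
unit modulo `M = Np^r`; `σ_s ∈ Gal(ℚ(ζ_M)/ℚ)` restricts to `Fr_p` on `ℚ(ζ_N)` (any lift acts the same on the ordinary
boundary module, on which `Gal(ℚ̄/ℚ(ζ_N))` acts trivially).
[cite: FukayaKato2024, Prop. 3.2.4 (Gal(ℚ̄/ℚ(ζ_N)) acts trivially on the ordinary boundary quotient) and 1.3.3] -/
theorem exists_frobenius_lift {p : ℕ} (hp : p.Prime) {N : ℕ} (hN : ¬ p ∣ N) (r : ℕ) :
    ∃ s : ℕ, s ≡ p [MOD N] ∧ s ≡ 1 [MOD p ^ r] ∧ Nat.Coprime s (N * p ^ r) := by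
  have hco : Nat.Coprime N (p ^ r) :=
    Nat.Coprime.pow_right r ((Nat.Prime.coprime_iff_not_dvd hp).mpr hN).symm
  obtain ⟨s, hsN, hsp⟩ := Nat.chineseRemainder hco p 1
  refine ⟨s, hsN, hsp, Nat.Coprime.mul_right ?_ ?_⟩
  · rw [Nat.Coprime, hsN.gcd_eq]
    exact ((Nat.Prime.coprime_iff_not_dvd hp).mpr hN)
  · rw [Nat.Coprime, hsp.gcd_eq, Nat.gcd_one_left]

/-- **The dictionary.** Ohta's `[a;c]` and Fukaya–Kato's `(c,d)` name the same cusp when `a d ≡ 1 (mod R)`,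
`R = gcd(c, M)`. If `s ≡ p (mod R)` (a Frobenius lift) and `p q ≡ 1 (mod R)`, then `(q a)·(s d) ≡ 1 (mod R)`: the label
`(c, s d) = σ_s·(c, d)` is Ohta's `[q a ; c]`. So `Fr_p[a;c] = [q a; c]` on the ordinary basis (ADD-7 (T5.2-b)).
[cite: FukayaKato2024, 1.3.2 (bottom-row labels) and 1.3.4 (σ acts on the Tate datum q^{c/M}ζ_M^d; ⟨c′⟩∘∞_M(a,b) = ∞_M(ac′,bc′))] -/
theorem dictionary_modEq {p q a d s R : ℤ} (had : a * d ≡ 1 [ZMOD R]) (hs : s ≡ p [ZMOD R])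
    (hq : p * q ≡ 1 [ZMOD R]) : (q * a) * (s * d) ≡ 1 [ZMOD R] := by
  have h1 : (q * a) * (s * d) ≡ (q * a) * (p * d) [ZMOD R] := (hs.mul_right d).mul_left (q * a)
  have e : (q * a) * (p * d) = (p * q) * (a * d) := by ring
  have h2 : (p * q) * (a * d) ≡ 1 * 1 [ZMOD R] := hq.mul had
  rw [mul_one] at h2
  exact h1.trans (e ▸ h2)

/-- Non-vacuity of the direction check (ADD-7 §3 (3b)): if the two candidate permutations `a ↦ q a` (`U′_p = T*(p)`,
`p q ≡ 1`) and `a ↦ p a` (`T(p)`) agree modulo `R` at ONE `a` coprime to `R`, then `p² ≡ 1 (mod R)`. So whenever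
`p² ≢ 1 (mod N)` there are ordinary cusps (`R = N`, e.g. `c = N`) on which `T*(p)` and `T(p)` differ, and the identity
`Fr_p = U′_p` genuinely pins the exponent.
[cite: FukayaKato2024, 1.2.3–1.2.5 (T(ℓ) and T*(ℓ) are transposes under Poincaré duality); Prop. 1.8.1 (arithmetic Frobenius = T*(p), the direction)] -/
theorem sq_modEq_one_of_mul_modEq_mul {p q a R : ℤ} (hq : p * q ≡ 1 [ZMOD R]) (ha : IsCoprime a R)
    (h : q * a ≡ p * a [ZMOD R]) : p ^ 2 ≡ 1 [ZMOD R] := by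
  -- cancel the unit `a`: `R ∣ (p - q) a ⇒ R ∣ p - q`
  have hdvd : R ∣ (p - q) * a := by
    have := Int.modEq_iff_dvd.mp h
    have e : p * a - q * a = (p - q) * a := by ring
    rwa [e] at this
  have hqp : q ≡ p [ZMOD R] := Int.modEq_iff_dvd.mpr (ha.symm.dvd_of_dvd_mul_right hdvd)
  have h2 : p * p ≡ p * q [ZMOD R] := (hqp.mul_left p).symm
  rw [sq]
  exact h2.trans hq

/-! ## §3 (T5.2-c) Assembled: both are the permutation `[a;c] ↦ [q a; c]` of Ohta's basis -/

/-- **T5.2 (reader 1, D-AUDIT-cgs25-r1-ADDENDUM-7 §2), the cusp arithmetic in kernel form.** Let `p` be a prime,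
`p ∤ N`, `r` a level exponent, `(a, c)` coprime integers with `p ∤ c` (an element `[a;c]` of Ohta's basis `𝔅_r` of the
ordinary boundary module `e*ℤ_p[C_r] = ℤ_p[C_r]/D_r` of `X₁(Np^r)`), `q` an inverse of `p` modulo `N`, and
`R := gcd(Np^r, c)` (the modulus of the first cusp coordinate). Then:
(0) `R ∣ c`, `R ∣ N` (so `q` is an inverse of `p` mod `R`, and `R = gcd(N, c)`);
(a) HECKE: there are `i₀, b` with `a + i₀c = p b`, `gcd(b, c) = 1`, `b ≡ q a (mod R)` — the surviving term of
`U′_p[a;c] = Σ_{i mod p}[(a+ic)/(pc)]` is the cusp `b/c` with label `[q a; c]` — while for every `i`, `p ∣ a + ic ⟺ i ≡ i₀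
(mod p)`, and for `i ≢ i₀` the column `(a+ic ; pc)` is primitive with `p ∣ pc` (its class lies in `D_r`); so
`U′_p[a;c] ≡ [q a; c] (mod D_r)`;
(b) FROBENIUS: a lift `s` of `Fr_p` (`s ≡ p (mod N)`, `s ≡ 1 (mod p^r)`, `gcd(s, Np^r) = 1`) exists, and for every such
`s` and every Fukaya–Kato second label `d` of the same cusp (`a d ≡ 1 (mod R)`), `(q a)(s d) ≡ 1 (mod R)` — the label
`(c, s d) = σ_s·(c, d)` is Ohta's `[q a; c]`; so `Fr_p[a;c] = [q a; c]`.
Hence arithmetic `Fr_p` and `U′_p` are the SAME permutation `[a;c] ↦ [q a; c]` of `𝔅_r`, for every `p ∤ N` and every `r`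
(the sheet's (T5.2-c); equality of the two operators on `e*ℤ_p[C_r]` follows on the basis). The printed frame (cusp
labels, `D_r`, `U′_p` = double-coset sum on cusps, Galois action on labels) is cited, not formalised.
[cite: Ohta1999, (4.3.1)–(4.3.4), Prop. (3.4.12), (4.3.10) (Compositio 115 §3.4, §4.3)] [cite: FukayaKato2024, 1.3.2–1.3.5, Prop. 3.2.4, 3.3.7 (the R = 1 case printed: «T*(p) … commutes with the identity maps on 0-cusps»)] [cite: Lafferty2019, §4.1.1–4.1.3] [cite: KingsLoefflerZerbes2017, Thm. 7.2.3(iii) (the target clause «arithmetic Frobenius acting via U′_p», corpus paper:arxiv-1503.02888 p0031:L66)] -/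
theorem frobenius_eq_hecke_on_ordinary_cusp_labels
    {p : ℕ} (hp : p.Prime) {N : ℕ} (hN : ¬ p ∣ N) (r : ℕ)
    {a c : ℤ} (hac : IsCoprime a c) (hc : ¬ (p : ℤ) ∣ c)
    {q : ℤ} (hq : (p : ℤ) * q ≡ 1 [ZMOD (N : ℤ)]) :
    ((Int.gcd ((N : ℤ) * (p : ℤ) ^ r) c : ℤ) ∣ c ∧ (Int.gcd ((N : ℤ) * (p : ℤ) ^ r) c : ℤ) ∣ (N : ℤ)) ∧
    (∃ i₀ b : ℤ, (p : ℤ) * b = a + i₀ * c ∧ IsCoprime b c ∧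
        b ≡ q * a [ZMOD (Int.gcd ((N : ℤ) * (p : ℤ) ^ r) c : ℤ)] ∧
        ∀ i : ℤ, ((p : ℤ) ∣ a + i * c ↔ i ≡ i₀ [ZMOD (p : ℤ)]) ∧
          (¬ i ≡ i₀ [ZMOD (p : ℤ)] → IsCoprime (a + i * c) ((p : ℤ) * c) ∧ (p : ℤ) ∣ (p : ℤ) * c)) ∧
    ((∃ s : ℕ, s ≡ p [MOD N] ∧ s ≡ 1 [MOD p ^ r] ∧ Nat.Coprime s (N * p ^ r)) ∧
      ∀ s d : ℤ, s ≡ (p : ℤ) [ZMOD (N : ℤ)] →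
        a * d ≡ 1 [ZMOD (Int.gcd ((N : ℤ) * (p : ℤ) ^ r) c : ℤ)] →
        (q * a) * (s * d) ≡ 1 [ZMOD (Int.gcd ((N : ℤ) * (p : ℤ) ^ r) c : ℤ)]) := by
  set R : ℤ := (Int.gcd ((N : ℤ) * (p : ℤ) ^ r) c : ℤ) with hR
  -- (0) `R ∣ c` and `R ∣ N`
  have hRc : R ∣ c := Int.gcd_dvd_right _ _
  have hRN : R ∣ (N : ℤ) := by
    rw [hR, gcd_mul_pow_eq_gcd hp hc N r]
    exact Int.gcd_dvd_left _ _
  have hqR : (p : ℤ) * q ≡ 1 [ZMOD R] := hq.of_dvd hRN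
  refine ⟨⟨hRc, hRN⟩, ?_, ?_⟩
  · -- (a) Hecke
    obtain ⟨i₀, h₀⟩ := exists_dvd_add_mul hp hc a
    obtain ⟨b, hb⟩ := h₀
    refine ⟨i₀, b, hb.symm, isCoprime_of_mul_eq_add_mul hac hb.symm,
      modEq_of_mul_eq_add_mul hRc hqR hb.symm, fun i => ⟨dvd_add_mul_iff_modEq hp hc ⟨b, hb⟩ i, fun hi => ?_⟩⟩
    have hi' : ¬ (p : ℤ) ∣ a + i * c := fun h => hi ((dvd_add_mul_iff_modEq hp hc ⟨b, hb⟩ i).mp h)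
    exact ⟨isCoprime_add_mul_mul hp hac hi', dvd_mul_right _ _⟩
  · -- (b) Frobenius
    refine ⟨exists_frobenius_lift hp hN r, fun s d hs had => ?_⟩
    exact dictionary_modEq had (hs.of_dvd hRN) hqR

end Literature.NumberTheory.ModularForms.OrdinaryCusps
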